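import Summits.Langlands.Langlands.Theses.IrreducibilityBySelfDuality

/-!
# `IrreducibleOffSector` is false without its guard `0 < n` (negative lemma, crux
stmt-Langlands-14329, route `IrreducibilityBySelfDuality`, line `Sketch`)

Load-bearing analysis of the hypothesis `0 < n` of the crux
`Summit.Langlands.Langlands.Theses.IrreducibilityBySelfDuality.IrreducibleOffSector`
("cuspidal ⇒ irreducible" off the sector `n = 3 ∧ K CM ∧ regular`): the same text WITHOUT
`0 < n` (stated inline in `irreducibleOffSector_false_without_pos`; it is the item's pre-repair
text of 2026-08-15) is FALSE, by an explicit junk witness in rank `n = 0` built here in full: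

* the constant function `1` is an automorphic form on `GL_n(𝔸_K)` for EVERY `n`
  (`isAutomorphicForm_constOne`) and `ℂ·1 / ⊥` is an automorphic representation datum
  (`exists_trivialRepData`, the trivial representation, zero Lie algebra action
  `hasLieAction_zero_of_W_eq`); for `n = 0` the cusp condition (`0 < k < n`) is empty, so it is
  a CUSPIDAL datum (`exists_trivialCuspidalZero`);
* in rank `0` it has Satake parameter `∅` at every finite place (`hasSatakeParamAt_empty_of_W_eq`:
  level `K(1)`, `T_{v,0} = [K 1 K] = 1`) and is L-algebraic with the empty infinity type
  (`isLAlgebraic_of_W_eq`), because every `𝔤𝔩₀(𝕜)`-module has Harish-Chandra parameter `∅`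
  (`hasHCParameter_finZero`: `U(𝔤𝔩₀) = ℝ`, `uea_exists_eq_algebraMap`);
* the trivial framed representation `Γ_ℚ →ₜ* GL_0(ℚ̄_2)` is unramified with Frobenius
  characteristic polynomial `1 = arithFrobPolyOfSatake ι q 1 ∅` everywhere, hence
  Satake–Frobenius compatible with the datum, and it is NOT irreducible (the lattice of
  subrepresentations of the zero module is a singleton, `not_isIrreducible_rank_zero`).

So any proof of the crux must use `0 < n` (the summit `Langlands` carries the same guard); the
repaired item is untouched. Recorded as negative knowledge for the line `Sketch`, whose
isobaric-rigidity stub needs the analogous guard `0 < m i` on the blocks for the same reason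
(a `GL_0` block pads every isobaric decomposition). No proposition is defined under `Summits/`.

References: A. Borel, H. Jacquet, *Automorphic forms and automorphic representations*,
Corvallis 1979, §4.2–4.6; K. Buzzard, T. Gee, *The conjectural connections between automorphic
representations and Galois representations* (2014), Def. 3.1.1.
-/

noncomputable section

-- `Summit.Langlands.Langlands.…` (summit = sub-problem name, D-0017 layout) trips `dupNamespace`.
set_option linter.dupNamespace false

open scoped NumberField Classical
open Filter IsDedekindDomain
open Literature.NumberTheory.Automorphic Literature.NumberTheory.GaloisRepresentations
open Summit.Langlands

namespace Summit.Langlands.Langlands.Theorems.IrreducibleOffSector.Negative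

/-! ### Rank zero: no framed representation is irreducible -/

/-- A framed representation of rank `0` is never irreducible: `IsIrreducible` is
`IsSimpleOrder` of the lattice of subrepresentations, which on the zero module `Fin 0 → A` is a
singleton (`⊥ = ⊤`). [folklore] -/
theorem not_isIrreducible_rank_zero {K : Type} [Field K] {A : Type} [Field A] [TopologicalSpace A]
    [IsTopologicalRing A] (ρ : FramedGaloisRep K A 0) : ¬ ρ.toGaloisRep.IsIrreducible := by
  intro h
  change IsSimpleOrder (Subrepresentation (FramedRep.toRepresentation ρ)) at h
  obtain ⟨⟨W₁, W₂, hne⟩⟩ := h.toNontrivial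
  apply hne
  have hW : ∀ W : Subrepresentation (FramedRep.toRepresentation ρ), W.toSubmodule = ⊥ := fun W =>
    Subsingleton.elim _ _
  exact Subrepresentation.toSubmodule_injective ((hW W₁).trans (hW W₂).symm)

/-! ### The trivial automorphic representation datum of `GL_n(𝔸_K)` -/

section Trivial

variable {n : ℕ} {K : Type} [Field K] [NumberField K] (hcpt : isCompact_glFiniteIntegralLevel n K)

/-- Lie derivatives of constant functions vanish (`deriv_const`). [folklore] -/
theorem lieDeriv_const (X : (AutomorphyDatum.gl n K hcpt).arch.lie) (c : ℂ) :
    lieDeriv (AutomorphyDatum.gl n K hcpt).ofArch X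
      (fun _ : (AdelicGroupData.gl n K).Adelic => c) = 0 := by
  funext g
  simp [lieDeriv]

/-- Lie derivatives vanish on the line `ℂ · 1`. [folklore] -/
theorem lieDeriv_of_mem_span (X : (AutomorphyDatum.gl n K hcpt).arch.lie)
    {φ : (AdelicGroupData.gl n K).Adelic → ℂ}
    (hφ : φ ∈ Submodule.span ℂ {fun _ : (AdelicGroupData.gl n K).Adelic => (1 : ℂ)}) :
    lieDeriv (AutomorphyDatum.gl n K hcpt).ofArch X φ = 0 := by
  obtain ⟨a, rfl⟩ := Submodule.mem_span_singleton.1 hφ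
  rw [lieDeriv_smul, lieDeriv_const hcpt X 1, smul_zero]

/-- Iterated Lie derivatives of `1` stay on the line `ℂ · 1` (they are `1` or `0`). [folklore] -/
theorem iterLieDeriv_const_mem (w : List (AutomorphyDatum.gl n K hcpt).arch.lie) :
    iterLieDeriv (AutomorphyDatum.gl n K hcpt).ofArch w
        (fun _ : (AdelicGroupData.gl n K).Adelic => (1 : ℂ)) ∈
      Submodule.span ℂ {fun _ : (AdelicGroupData.gl n K).Adelic => (1 : ℂ)} := by
  induction w with
  | nil => rw [iterLieDeriv_nil]; exact Submodule.mem_span_singleton_self _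
  | cons X w ih =>
    rw [iterLieDeriv_cons, lieDeriv_of_mem_span hcpt X ih]
    exact Submodule.zero_mem _

/-- The word action of `ℝ⟨𝔤⟩` keeps `1` on the line `ℂ · 1`. [folklore] -/
theorem applyFree_const_mem (p : FreeAlgebra ℝ (AutomorphyDatum.gl n K hcpt).arch.lie) :
    applyFree (AutomorphyDatum.gl n K hcpt).ofArch p
        (fun _ : (AdelicGroupData.gl n K).Adelic => (1 : ℂ)) ∈
      Submodule.span ℂ {fun _ : (AdelicGroupData.gl n K).Adelic => (1 : ℂ)} := by
  rw [applyFree, Finsupp.sum]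
  exact Submodule.sum_mem _ fun w _ => Submodule.smul_mem _ _ (iterLieDeriv_const_mem hcpt _)

open scoped Matrix.Norms.Operator in
/-- Constant functions are smooth in the archimedean variable. [folklore] -/
theorem isArchSmooth_const (c : ℂ) :
    IsArchSmooth (AutomorphyDatum.gl n K hcpt).ofArch
      (fun _ : (AdelicGroupData.gl n K).Adelic => c) :=
  fun _ => contDiff_const

/-- **The constant function `1` is an automorphic form on `GL_n(𝔸_K)`** for every `n`: left
`GL_n(K)`-invariant, right invariant under the integral level, smooth, `K_∞`- and `Z(𝔤)`-finite
(its translates and derivatives lie on `ℂ · 1`), of moderate growth with `C = 1, r = 0`.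
Borel–Jacquet 1979, 4.2. [folklore] -/
theorem isAutomorphicForm_constOne :
    IsAutomorphicForm (AutomorphyDatum.gl n K hcpt)
      (fun _ : (AdelicGroupData.gl n K).Adelic => (1 : ℂ)) := by
  refine ⟨?_, ?_, ?_, ?_, ?_, ?_⟩
  · intro γ _ g; rfl
  · exact ⟨glIntegralLevel n K, glIntegralLevel_mem_finiteLevelsGL n K hcpt, fun u _ g => rfl⟩
  · exact isArchSmooth_const hcpt 1
  · change FiniteDimensional ℂ (kTranslateSpan (AutomorphyDatum.gl n K hcpt).ofArch _)
    refine Submodule.finiteDimensional_of_le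
      (S₂ := Submodule.span ℂ {fun _ : (AdelicGroupData.gl n K).Adelic => (1 : ℂ)})
      (Submodule.span_le.2 ?_)
    rintro _ ⟨k, rfl⟩
    exact Submodule.mem_span_singleton_self _
  · change FiniteDimensional ℂ (zOrbitSpan (AutomorphyDatum.gl n K hcpt).ofArch _)
    refine Submodule.finiteDimensional_of_le
      (S₂ := Submodule.span ℂ {fun _ : (AdelicGroupData.gl n K).Adelic => (1 : ℂ)})
      (Submodule.span_le.2 ?_)
    rintro _ ⟨p, -, rfl⟩
    exact applyFree_const_mem hcpt p
  · refine ⟨1, 0, fun g => ?_⟩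
    simp

/-- The line `ℂ · 1` is a stable submodule of the space of automorphic forms. [folklore] -/
theorem isStableSubmodule_span_constOne :
    IsStableSubmodule (AutomorphyDatum.gl n K hcpt)
      (Submodule.span ℂ {fun _ : (AdelicGroupData.gl n K).Adelic => (1 : ℂ)}) where
  le_automorphicForms := Submodule.span_le.2 (by
    rintro _ rfl
    exact (isAutomorphicForm_constOne hcpt).mem_automorphicForms)
  finite_stable h _ := Submodule.span_le.2 (by
    rintro _ rfl
    exact Submodule.mem_span_singleton_self _)
  k_stable k := Submodule.span_le.2 (by
    rintro _ rfl
    exact Submodule.mem_span_singleton_self _)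
  lie_stable X φ hφ := by
    rw [lieDeriv_of_mem_span hcpt X hφ]
    exact Submodule.zero_mem _

/-- `1 ≠ 0` as a function on `GL_n(𝔸_K)`. [folklore] -/
theorem constOne_ne_zero : (fun _ : (AdelicGroupData.gl n K).Adelic => (1 : ℂ)) ≠ 0 := fun h => by
  have := congrFun h 1
  simp at this

/-- **The trivial automorphic representation datum** `ℂ · 1 / ⊥` of `GL_n(𝔸_K)` exists (a line
has no proper non-zero subspace). Borel–Jacquet 1979, 4.6. [folklore] -/
theorem exists_trivialRepData :
    ∃ π : AutomorphicRepData (AutomorphyDatum.gl n K hcpt),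
      π.W = Submodule.span ℂ {fun _ : (AdelicGroupData.gl n K).Adelic => (1 : ℂ)} ∧ π.W' = ⊥ := by
  refine ⟨{ W := Submodule.span ℂ {fun _ : (AdelicGroupData.gl n K).Adelic => (1 : ℂ)}
            W' := ⊥
            lt := bot_lt_iff_ne_bot.2 (by
              rw [Ne, Submodule.span_singleton_eq_bot]; exact constOne_ne_zero)
            stable := isStableSubmodule_span_constOne hcpt
            stable' := isStableSubmodule_bot _
            irreducible := fun W'' _ h₂ _ => ?_ }, rfl, rfl⟩
  rcases eq_or_lt_of_le h₂ with h | h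
  · exact Or.inr h
  · exact Or.inl ((nonzero_span_atom _ constOne_ne_zero).2 _ h)

/-- A datum realised on `ℂ · 1` carries the ZERO Lie algebra action (derivatives of constants
vanish). [folklore] -/
theorem hasLieAction_zero_of_W_eq (π : AutomorphicRepData (AutomorphyDatum.gl n K hcpt))
    (hW : π.W = Submodule.span ℂ {fun _ : (AdelicGroupData.gl n K).Adelic => (1 : ℂ)}) :
    π.HasLieAction 0 := by
  intro X φ
  have h0 : π.lieDerivW X φ = 0 := Subtype.ext (by
    change lieDeriv (AutomorphyDatum.gl n K hcpt).ofArch X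
      (φ : (AdelicGroupData.gl n K).Adelic → ℂ) = 0
    exact lieDeriv_of_mem_span hcpt X (hW ▸ φ.2))
  rw [h0, map_zero]
  rfl

end Trivial

/-! ### Rank zero: Harish-Chandra parameters are empty -/

/-- The universal enveloping algebra of a ZERO Lie algebra is the scalars: every element is
`algebraMap ℝ _ r` (induction over the tensor algebra; `ι x = ι 0 = 0`).
Dixmier, *Enveloping algebras*, 2.1.1. [folklore] -/
theorem uea_exists_eq_algebraMap {L : Type*} {_ : LieRing L} {_ : LieAlgebra ℝ L} [Subsingleton L]
    (u : UniversalEnvelopingAlgebra ℝ L) : ∃ r : ℝ, algebraMap ℝ _ r = u := by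
  have hs : Function.Surjective (UniversalEnvelopingAlgebra.mkAlgHom ℝ L) :=
    RingCon.mkₐ_surjective _
  obtain ⟨t, rfl⟩ := hs u
  suffices h : UniversalEnvelopingAlgebra.mkAlgHom ℝ L t ∈ (⊥ : Subalgebra ℝ _) by
    simpa [Algebra.mem_bot] using h
  induction t using TensorAlgebra.induction with
  | algebraMap r => rw [AlgHom.commutes]; exact Subalgebra.algebraMap_mem _ r
  | ι x =>
    rw [Subsingleton.elim x 0, map_zero, map_zero]; exact Subalgebra.zero_mem _
  | mul a b ha hb => rw [map_mul]; exact Subalgebra.mul_mem _ ha hb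
  | add a b ha hb => rw [map_add]; exact Subalgebra.add_mem _ ha hb

/-- **Rank zero: every `𝔤𝔩₀(𝕜)`-module has Harish-Chandra parameter `τ ↦ ∅`.** The centre of
`U(𝔤𝔩₀) = ℝ` acts through the augmentation (lift of the zero Lie homomorphism to `ℂ`), and every
Harish-Chandra homomorphism sends the scalar `r` to the constant polynomial `r`.
Knapp, *Lie Groups Beyond an Introduction*, Thm. 5.44 (degenerate case `n = 0`). (The Lie
algebra action `ρ𝔤 : 𝔤𝔩₀(𝕜) →ₗ⁅ℝ⁆ End_ℂ V` is an implicit argument: its type carries the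
commutator Lie structures of `HarishChandraGL`.) [folklore] -/
theorem hasHCParameter_finZero {𝕜 : Type*} [RCLike 𝕜] {V : Type*} [AddCommGroup V] [Module ℂ V]
    {ρ𝔤} : HasHCParameter (𝕜 := 𝕜) (n := 0) (V := V) ρ𝔤 (fun _ => 0) := by
  letI : LieRing (Matrix (Fin 0) (Fin 0) 𝕜) := LieRing.ofAssociativeRing
  letI : LieAlgebra ℝ (Matrix (Fin 0) (Fin 0) 𝕜) := LieAlgebra.ofAssociativeAlgebra
  letI : LieRing ℂ := LieRing.ofAssociativeRing
  letI : LieAlgebra ℝ ℂ := LieAlgebra.ofAssociativeAlgebra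
  refine ⟨fun _ => rfl, (UniversalEnvelopingAlgebra.lift ℝ (0 : Matrix (Fin 0) (Fin 0) 𝕜 →ₗ⁅ℝ⁆ ℂ)).comp
    (Subalgebra.val _), ?_, ?_⟩
  · intro z
    obtain ⟨r, hr⟩ := uea_exists_eq_algebraMap z.1
    rw [← hr, AlgHom.commutes, AlgHom.comp_apply, Subalgebra.coe_val, ← hr, AlgHom.commutes]
    rw [Algebra.algebraMap_eq_smul_one, Algebra.algebraMap_eq_smul_one, Complex.coe_algebraMap]
    exact (Complex.coe_smul r _).symm
  · intro γ l _ z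
    obtain ⟨r, hr⟩ := uea_exists_eq_algebraMap z.1
    have hz : z = algebraMap ℝ _ r := Subtype.ext (by rw [← hr]; rfl)
    rw [hz, AlgHom.commutes, AlgHom.commutes,
      IsScalarTower.algebraMap_apply ℝ ℂ (MvPolynomial _ ℂ) r, MvPolynomial.algebraMap_eq,
      MvPolynomial.aeval_C]
    simp

/-! ### The cuspidal `GL_0` witness -/

section RankZero

variable {K : Type} [Field K] [NumberField K] (hcpt : isCompact_glFiniteIntegralLevel 0 K)

/-- **The junk cuspidal datum of `GL_0(𝔸_K)`**: the trivial datum `ℂ · 1 / ⊥` is cuspidal in rank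
`0`, where the cusp conditions (`0 < k < 0`) are empty. [folklore] -/
theorem exists_trivialCuspidalZero :
    ∃ π : CuspidalAutomorphicRepData 0 K hcpt,
      π.1.W = Submodule.span ℂ {fun _ : (AdelicGroupData.gl 0 K).Adelic => (1 : ℂ)} ∧
        π.1.W' = ⊥ := by
  obtain ⟨π, hW, hW'⟩ := exists_trivialRepData hcpt
  refine ⟨⟨π, ?_⟩, hW, hW'⟩
  rw [hW]
  exact Submodule.span_le.2 (by
    rintro _ rfl
    exact Submodule.subset_span
      ⟨isAutomorphicForm_constOne hcpt, fun k hk hk0 => absurd hk0 (by omega)⟩)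

/-- **A `GL_0` datum on `ℂ · 1 / ⊥` has Satake parameter `∅` at EVERY finite place**: level
`K(1)` (`⊤ ≠ 0`, `v ∤ ⊤`), any uniformizer, the form `1`, and `T_{v,0} = [K(1) · 1 · K(1)] = 1`
with eigenvalue `q_v⁰ e₀(∅) = 1`. [folklore] -/
theorem hasSatakeParamAt_empty_of_W_eq (π : AutomorphicRepData (AutomorphyDatum.gl 0 K hcpt))
    (hW : π.W = Submodule.span ℂ {fun _ : (AdelicGroupData.gl 0 K).Adelic => (1 : ℂ)})
    (hW' : π.W' = ⊥) (v : HeightOneSpectrum (𝓞 K)) : π.HasSatakeParamAt v ∅ := by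
  refine ⟨⊤, HeckeCharacter.uniformizer K v, by simp, ?_, HeckeCharacter.valued_uniformizer v,
    by simp, fun _ => (1 : ℂ), ?_, ?_, fun u _ => rfl, fun i hi => ?_⟩
  · intro h
    exact v.isPrime.ne_top (top_le_iff.mp (Ideal.le_of_dvd h))
  · rw [hW]; exact Submodule.mem_span_singleton_self _
  · rw [hW', Submodule.mem_bot]; exact constOne_ne_zero
  · obtain rfl : i = 0 := Nat.le_zero.mp hi
    have hfix : (fun _ : (AdelicGroupData.gl 0 K).Adelic => (1 : ℂ)) ∈
        (rightTranslation (AdelicGroupData.gl 0 K)).fixedPoints (principalCongruenceLevel 0 K ⊤) :=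
      (isRightInvariantUnder_iff_mem_fixedPoints (AdelicGroupData.gl 0 K) _ _).1 fun u _ g => rfl
    have key : heckeOperator (rightTranslation (AdelicGroupData.gl 0 K))
        (principalCongruenceLevel 0 K ⊤) (heckeDiagAt 0 K v (HeckeCharacter.uniformizer K v) 0)
        (fun _ : (AdelicGroupData.gl 0 K).Adelic => (1 : ℂ)) = fun _ => (1 : ℂ) := by
      rw [heckeDiagAt_zero]
      exact heckeOperator_one_apply _ _ hfix
    rw [hW', Submodule.mem_bot, key]
    have h1 : ((((Real.sqrt (v.residueCard : ℝ)) : ℝ) : ℂ) ^ (0 * (0 - 0)) *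
        (∅ : Multiset ℂ).esymm 0) = 1 := by simp [Multiset.esymm]
    rw [h1, one_smul, sub_self]

/-- **A `GL_0` datum on `ℂ · 1` is L-algebraic**, with the empty infinity type: the zero Lie
algebra action (`hasLieAction_zero_of_W_eq`) has Harish-Chandra parameter `∅` at every real and
complex place (`hasHCParameter_finZero`), the empty type is well formed, and the integrality
condition is empty. Buzzard–Gee 2014, Def. 3.1.1. [folklore] -/
theorem isLAlgebraic_of_W_eq (π : AutomorphicRepData (AutomorphyDatum.gl 0 K hcpt))
    (hW : π.W = Submodule.span ℂ {fun _ : (AdelicGroupData.gl 0 K).Adelic => (1 : ℂ)}) :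
    π.IsLAlgebraic := by
  refine ⟨fun _ => 0, ⟨⟨fun _ => rfl, fun _ => by simp⟩, 0, hasLieAction_zero_of_W_eq hcpt π hW,
    fun w => ?_, fun w => ?_⟩, fun σ p hp => by simp at hp⟩
  · simpa using hasHCParameter_finZero
  · simpa using hasHCParameter_finZero

end RankZero

/-! ### The negative lemma -/

/-- **`IrreducibleOffSector` is false without `0 < n`.** The proposition negated is the crux
`Summit.Langlands.Langlands.Theses.IrreducibilityBySelfDuality.IrreducibleOffSector` with the
guard `0 < n →` deleted, everything else verbatim (the item's text before the refuter repair of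
2026-08-15T19:25Z). Witness: `n = 0`, `K = ℚ`, the junk cuspidal datum `ℂ · 1 / ⊥` of
`GL_0(𝔸_ℚ)` (L-algebraic, off the sector since `0 ≠ 3`, Satake parameter `∅` everywhere), `ℓ = 2`,
any `ι : ℚ̄₂ ≃+* ℂ` (`PadicAlgCl.nonempty_ringEquiv_complex`), and the trivial
`ρ : Γ_ℚ →ₜ* GL_0(ℚ̄₂)` — unramified with `charpoly = 1 = arithFrobPolyOfSatake ι q 1 ∅`
everywhere, hence compatible, and not irreducible (`not_isIrreducible_rank_zero`). So the guard
`0 < n` of the repaired crux is load-bearing (as is the guard `0 < m i` on the blocks of any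
isobaric-rigidity statement used on the line `Sketch`). [folklore] -/
theorem irreducibleOffSector_false_without_pos :
    ¬ (∀ (n : ℕ) (K : Type) [Field K] [NumberField K]
        (hcpt : Literature.NumberTheory.Automorphic.isCompact_glFiniteIntegralLevel n K),
        ∀ (π : Literature.NumberTheory.Automorphic.CuspidalAutomorphicRepData n K hcpt),
          π.1.IsLAlgebraic →
          ¬ (n = 3 ∧ NumberField.IsCMField K ∧
              ∃ T : Literature.NumberTheory.Automorphic.InfinityType K n,
                π.1.HasInfinityType T ∧ T.IsRegular) →
          ∀ (ℓ : ℕ) [Fact ℓ.Prime] (ι : PadicAlgCl ℓ ≃+* ℂ)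
            (ρ : Literature.NumberTheory.GaloisRepresentations.FramedGaloisRep K (PadicAlgCl ℓ) n),
            (∀ᶠ v : IsDedekindDomain.HeightOneSpectrum (NumberField.RingOfIntegers K) in cofinite,
              SatakeFrobCompatibleAt ι π.1 ρ v) →
            ρ.toGaloisRep.IsIrreducible) := by
  intro h
  obtain ⟨ι⟩ := PadicAlgCl.nonempty_ringEquiv_complex 2
  have hcpt : isCompact_glFiniteIntegralLevel 0 ℚ := isCompact_glFiniteIntegralLevel_holds 0 ℚ
  obtain ⟨π, hW, hW'⟩ := exists_trivialCuspidalZero hcpt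
  refine not_isIrreducible_rank_zero (1 : FramedGaloisRep ℚ (PadicAlgCl 2) 0)
    (h 0 ℚ hcpt π (isLAlgebraic_of_W_eq hcpt π.1 hW)
      (fun hs => absurd hs.1 (by decide)) 2 ι 1 (Filter.Eventually.of_forall fun v => ?_))
  refine ⟨∅, hasSatakeParamAt_empty_of_W_eq hcpt π.1 hW hW' v, fun 𝔓 _ σ _ => rfl,
    fun 𝔓 _ σ _ => ?_⟩
  simp [FramedRep.charpoly, Matrix.charpoly, arithFrobPolyOfSatake]

end Summit.Langlands.Langlands.Theorems.IrreducibleOffSector.Negative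

end
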